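import Summits.AtomisticToContinuum.Crystallization.Theorems.VdwKissingSutherlandSutherlandBoundBarlow
import Literature.MathematicalPhysics.StatisticalMechanics.MuGSC

/-!
# `SutherlandBound` (stmt-AtomisticToContinuum-3268) holds for every Barlow packing

Companion of `VdwKissingSutherlandSutherlandBoundBarlow.lean` (`barlowSiteEnergy_invSix_le_alternating`:
hcp has the largest `r⁻⁶` site energy among all Barlow stackings).  Here the sitewise domination is
turned into the item's own inequality on its natural test class:

* `summable_invSix_barlowPos_of_word` — `r⁻⁶` is summable over every Barlow stacking (uniform
  discreteness; no periodicity);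
* `tsum_invSix_barlowPos_eq_two_mul_barlowSiteEnergy`, `tsum_invSix_barlowPos_site` — the full
  `r⁻⁶` sum of the stacking seen from any site `(k, i, j)` is `2 · barlowSiteEnergy (r ↦ r⁻⁶) · · s k`;
* `hcp_tsum_eq_two_mul_barlowSiteEnergy` — `L₆(hcp) = 2 · barlowSiteEnergy (r ↦ r⁻⁶) 1 √(2/3) alternatingHagg 0`;
* `sutherlandBound_barlow` — **for every Hägg word `s` and every finite family of distinct points
  `x` of `barlowStacking 1 √(2/3) s`, `Σ_i Σ_j |x_i − x_j|⁻⁶ ≤ N · L₆(hcp)`**: the item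
  `SutherlandBound` restricted to close-packed packings (fcc, hcp, dhcp, all polytypes, all
  aperiodic stackings); `sutherlandBound_of_barlow_points` is the same in the item's own wording
  (unit-packing hypothesis).  Any counterexample to the item must therefore be a non-Barlow packing.

[folklore]
-/

noncomputable section

namespace Summit.AtomisticToContinuum.Crystallization.Theorems

open Literature.MathematicalPhysics.StatisticalMechanics

variable {a h : ℝ}

/-- **`r⁻⁶` is summable over every Barlow stacking** (`a, h > 0`, any word `s`, any base point
`x`), in the parametrisation by `ℤ³`: the stacking is uniformly discrete (`min a h`-separated), so
`UniformlyDiscrete.summable_of_abs_le_inv_pow_six` applies; no periodicity is needed. [folklore] -/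
theorem summable_invSix_barlowPos_of_word (ha : 0 < a) (hh : 0 < h) (s : ℤ → ℤ)
    (x : EuclideanSpace ℝ (Fin 3)) :
    Summable fun q : ℤ × ℤ × ℤ => (dist x (barlowPos a h s q.1 q.2.1 q.2.2))⁻¹ ^ 6 := by
  have hX : UniformlyDiscrete (barlowStacking a h s) :=
    ⟨min a h, lt_min ha hh, fun y hy z hz hyz =>
      le_dist_of_mem_barlowStacking a h s ha.le hh.le hy hz hyz⟩
  have hV : ∀ t : ℝ, (1 : ℝ) ≤ t → |(fun t : ℝ => t⁻¹ ^ 6) t| ≤ 1 * t⁻¹ ^ 6 := fun t _ => by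
    rw [one_mul, abs_of_nonneg (by positivity)]
  have hF : Summable fun y : ↥(barlowStacking a h s) =>
      (fun t : ℝ => t⁻¹ ^ 6) (dist x (y : EuclideanSpace ℝ (Fin 3))) :=
    hX.summable_of_abs_le_inv_pow_six one_pos hV x
  have hg : Function.Injective fun q : ℤ × ℤ × ℤ => barlowPos a h s q.1 q.2.1 q.2.2 :=
    barlowPos_injective ha hh s
  let φ : ℤ × ℤ × ℤ → ↥(barlowStacking a h s) :=
    fun q => ⟨barlowPos a h s q.1 q.2.1 q.2.2, barlowPos_mem _ _ _⟩
  have hφ : Function.Injective φ := fun q q' hqq' => hg (congrArg Subtype.val hqq')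
  have h2 : Summable ((fun y : ↥(barlowStacking a h s) =>
      (fun t : ℝ => t⁻¹ ^ 6) (dist x (y : EuclideanSpace ℝ (Fin 3)))) ∘ φ) :=
    hF.comp_injective hφ
  exact h2

/-- **The `r⁻⁶` sum over a Barlow stacking seen from the base point of layer `m` is twice the
site energy** `barlowSiteEnergy (r ↦ r⁻⁶) a h s m` (the same absolutely convergent sum organised
layer by layer; the diagonal term is `0⁻¹ ^ 6 = 0`). [folklore] -/
theorem tsum_invSix_barlowPos_eq_two_mul_barlowSiteEnergy (ha : 0 < a) (hh : 0 < h) (s : ℤ → ℤ)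
    (m : ℤ) :
    ∑' q : ℤ × ℤ × ℤ, (fun r : ℝ => r⁻¹ ^ 6)
        (dist (barlowPos a h s m 0 0) (barlowPos a h s q.1 q.2.1 q.2.2)) =
      2 * barlowSiteEnergy (fun r : ℝ => r⁻¹ ^ 6) a h s m := by
  have hF := summable_invSix_barlowPos_of_word ha hh s (barlowPos a h s m 0 0)
  have e2 : ∑' q : ℤ × ℤ × ℤ, (fun r : ℝ => r⁻¹ ^ 6)
      (dist (barlowPos a h s m 0 0) (barlowPos a h s q.1 q.2.1 q.2.2)) =
      ∑' k : ℤ, layerInteraction (fun r : ℝ => r⁻¹ ^ 6) a h (haggLabel s k - haggLabel s m)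
        (k - m) :=
    hF.tsum_prod.trans (tsum_congr fun k => tsum_layer (fun r : ℝ => r⁻¹ ^ 6) a h s m k)
  have hG : Summable fun k : ℤ =>
      layerInteraction (fun r : ℝ => r⁻¹ ^ 6) a h (haggLabel s k - haggLabel s m) (k - m) :=
    hF.prod.congr fun k => tsum_layer (fun r : ℝ => r⁻¹ ^ 6) a h s m k
  have e1 : ∑' k : ℤ, layerInteraction (fun r : ℝ => r⁻¹ ^ 6) a h
        (haggLabel s k - haggLabel s m) (k - m) =
      ∑' t : ℤ, layerInteraction (fun r : ℝ => r⁻¹ ^ 6) a h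
        (haggLabel s (m + t) - haggLabel s m) (m + t - m) :=
    ((Equiv.addLeft m).tsum_eq fun k =>
      layerInteraction (fun r : ℝ => r⁻¹ ^ 6) a h (haggLabel s k - haggLabel s m) (k - m)).symm
  have hG' : Summable fun t : ℤ => layerInteraction (fun r : ℝ => r⁻¹ ^ 6) a h
      (haggLabel s (m + t) - haggLabel s m) (m + t - m) :=
    hG.comp_injective (Equiv.addLeft m).injective
  have h1 : Summable fun n : ℕ => layerInteraction (fun r : ℝ => r⁻¹ ^ 6) a h
      (haggLabel s (m + ((n : ℤ) + 1)) - haggLabel s m) (m + ((n : ℤ) + 1) - m) :=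
    hG'.comp_injective (i := fun n : ℕ => (n : ℤ) + 1)
      fun n n' (hn : (n : ℤ) + 1 = (n' : ℤ) + 1) => by omega
  have h2 : Summable fun n : ℕ => layerInteraction (fun r : ℝ => r⁻¹ ^ 6) a h
      (haggLabel s (m + -((n : ℤ) + 1)) - haggLabel s m) (m + -((n : ℤ) + 1) - m) :=
    hG'.comp_injective (i := fun n : ℕ => -((n : ℤ) + 1))
      fun n n' (hn : -((n : ℤ) + 1) = -((n' : ℤ) + 1)) => by omega
  have e3 : ∑' t : ℤ, layerInteraction (fun r : ℝ => r⁻¹ ^ 6) a h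
        (haggLabel s (m + t) - haggLabel s m) (m + t - m) =
      (∑' n : ℕ, layerInteraction (fun r : ℝ => r⁻¹ ^ 6) a h
        (haggLabel s (m + ((n : ℤ) + 1)) - haggLabel s m) (m + ((n : ℤ) + 1) - m)) +
      layerInteraction (fun r : ℝ => r⁻¹ ^ 6) a h (haggLabel s (m + 0) - haggLabel s m)
        (m + 0 - m) +
      ∑' n : ℕ, layerInteraction (fun r : ℝ => r⁻¹ ^ 6) a h
        (haggLabel s (m + -((n : ℤ) + 1)) - haggLabel s m) (m + -((n : ℤ) + 1) - m) :=
    tsum_of_add_one_of_neg_add_one (f := fun t : ℤ =>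
      layerInteraction (fun r : ℝ => r⁻¹ ^ 6) a h (haggLabel s (m + t) - haggLabel s m)
        (m + t - m)) h1 h2
  have e0 : layerInteraction (fun r : ℝ => r⁻¹ ^ 6) a h (haggLabel s (m + 0) - haggLabel s m)
      (m + 0 - m) =
      ∑' ij : ℤ × ℤ, (if ij = 0 then 0 else
        (fun r : ℝ => r⁻¹ ^ 6) (dist (barlowPos a h s m 0 0) (barlowPos a h s m ij.1 ij.2))) := by
    rw [add_zero, sub_self, sub_self, tsum_inLayer (fun r : ℝ => r⁻¹ ^ 6), layerInteraction,
      inLayerInteraction]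
    refine tsum_congr fun ij => ?_
    split_ifs with hij
    · subst hij
      simp [layerVec]
    · rw [layerVec_zero_zero]
  have eB : (∑' n : ℕ, layerInteraction (fun r : ℝ => r⁻¹ ^ 6) a h
        (haggLabel s (m + ((n : ℤ) + 1)) - haggLabel s m) (m + ((n : ℤ) + 1) - m)) =
      ∑' k : ℕ, ∑' ij : ℤ × ℤ, (fun r : ℝ => r⁻¹ ^ 6)
        (dist (barlowPos a h s m 0 0) (barlowPos a h s (m + (k + 1 : ℕ)) ij.1 ij.2)) :=
    tsum_congr fun n => by
      rw [tsum_layer (fun r : ℝ => r⁻¹ ^ 6)]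
      have : m + ((n : ℤ) + 1) = m + ((n + 1 : ℕ) : ℤ) := by push_cast; ring
      rw [this]
  have eC : (∑' n : ℕ, layerInteraction (fun r : ℝ => r⁻¹ ^ 6) a h
        (haggLabel s (m + -((n : ℤ) + 1)) - haggLabel s m) (m + -((n : ℤ) + 1) - m)) =
      ∑' k : ℕ, ∑' ij : ℤ × ℤ, (fun r : ℝ => r⁻¹ ^ 6)
        (dist (barlowPos a h s m 0 0) (barlowPos a h s (m - (k + 1 : ℕ)) ij.1 ij.2)) :=
    tsum_congr fun n => by
      rw [tsum_layer (fun r : ℝ => r⁻¹ ^ 6)]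
      have : m + -((n : ℤ) + 1) = m - ((n + 1 : ℕ) : ℤ) := by push_cast; ring
      rw [this]
  rw [e2, e1, e3, e0, eB, eC, barlowSiteEnergy]
  ring

/-- **In-layer translation invariance**: the `r⁻⁶` sum over the stacking seen from the site
`(k₀, i₀, j₀)` equals that seen from the base point `(k₀, 0, 0)` of its layer (reindex
`(i, j) ↦ (i + i₀, j + j₀)`). [folklore] -/
theorem tsum_invSix_barlowPos_site (a h : ℝ) (s : ℤ → ℤ) (k₀ i₀ j₀ : ℤ) :
    ∑' q : ℤ × ℤ × ℤ, (fun r : ℝ => r⁻¹ ^ 6)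
        (dist (barlowPos a h s k₀ i₀ j₀) (barlowPos a h s q.1 q.2.1 q.2.2)) =
      ∑' q : ℤ × ℤ × ℤ, (fun r : ℝ => r⁻¹ ^ 6)
        (dist (barlowPos a h s k₀ 0 0) (barlowPos a h s q.1 q.2.1 q.2.2)) := by
  let e : ℤ × ℤ × ℤ ≃ ℤ × ℤ × ℤ :=
    (Equiv.refl ℤ).prodCongr ((Equiv.addRight i₀).prodCongr (Equiv.addRight j₀))
  rw [← e.tsum_eq]
  refine tsum_congr fun q => ?_
  show (fun r : ℝ => r⁻¹ ^ 6)
      (dist (barlowPos a h s k₀ i₀ j₀) (barlowPos a h s q.1 (q.2.1 + i₀) (q.2.2 + j₀))) = _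
  rw [dist_barlowPos_eq_norm_layerVec, dist_barlowPos_eq_norm_layerVec, add_sub_cancel_right,
    add_sub_cancel_right, sub_zero, sub_zero]

/-- **`L₆(hcp)` is twice the `r⁻⁶` site energy of hcp**:
`∑' y ∈ hcpStacking 1 √(2/3), ‖y‖⁻⁶ = 2 · barlowSiteEnergy (r ↦ r⁻⁶) 1 √(2/3) alternatingHagg 0`
(the stacking is the bijective image of `ℤ³` under `barlowPos`; the site `0` is `barlowPos 0 0 0`).
[folklore] -/
theorem hcp_tsum_eq_two_mul_barlowSiteEnergy :
    (∑' y : ↥(hcpStacking 1 (Real.sqrt (2 / 3))), ‖(y : EuclideanSpace ℝ (Fin 3))‖⁻¹ ^ 6) =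
      2 * barlowSiteEnergy (fun r : ℝ => r⁻¹ ^ 6) 1 (Real.sqrt (2 / 3)) alternatingHagg 0 := by
  have ha : (0 : ℝ) < 1 := one_pos
  have hh : 0 < Real.sqrt (2 / 3) := Real.sqrt_pos.2 (by norm_num)
  rw [← tsum_invSix_barlowPos_eq_two_mul_barlowSiteEnergy ha hh alternatingHagg 0]
  set g : ℤ × ℤ × ℤ → EuclideanSpace ℝ (Fin 3) :=
    fun q => barlowPos 1 (Real.sqrt (2 / 3)) alternatingHagg q.1 q.2.1 q.2.2 with hgdef
  have hg : Function.Injective g := barlowPos_injective ha hh _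
  have hrange : Set.range g = hcpStacking 1 (Real.sqrt (2 / 3)) := by
    ext y
    constructor
    · rintro ⟨q, rfl⟩
      exact barlowPos_mem _ _ _
    · rintro ⟨k, i, j, rfl⟩
      exact ⟨(k, i, j), rfl⟩
  let e : ℤ × ℤ × ℤ ≃ ↥(hcpStacking 1 (Real.sqrt (2 / 3))) :=
    (Equiv.ofInjective g hg).trans (Equiv.setCongr hrange)
  rw [← e.tsum_eq]
  refine tsum_congr fun q => ?_
  have hq : ((e q : ↥(hcpStacking 1 (Real.sqrt (2 / 3)))) : EuclideanSpace ℝ (Fin 3)) = g q := rfl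
  rw [hq]
  have h0 : barlowPos 1 (Real.sqrt (2 / 3)) alternatingHagg 0 0 0 = 0 := by simp [barlowPos]
  show ‖g q‖⁻¹ ^ 6 = (dist (barlowPos 1 (Real.sqrt (2 / 3)) alternatingHagg 0 0 0) (g q))⁻¹ ^ 6
  rw [h0, dist_zero_left]

/-- **`SutherlandBound` holds for every Barlow packing.** For every Hägg word `s` and every
finite family `x` of distinct points of the close-packed stacking `barlowStacking 1 √(2/3) s`
(nearest-neighbour distance `1`; fcc, hcp, dhcp, 9R, every polytype and every aperiodic stacking),
`Σ_i Σ_j |x_i − x_j|⁻⁶ ≤ N · L₆(hcp)`: each site sum is at most the full `r⁻⁶` sum of the stacking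
from that site, `= 2 · barlowSiteEnergy (r ↦ r⁻⁶) 1 √(2/3) s (layer)`, which is at most hcp's
(`barlowSiteEnergy_invSix_le_alternating`), `= L₆(hcp)`.  So any counterexample to the item must be
a non-close-packed packing. [folklore] -/
theorem sutherlandBound_barlow {s : ℤ → ℤ} (hs : IsHaggSeq s) {N : ℕ}
    (x : Fin N → EuclideanSpace ℝ (Fin 3)) (hx : Function.Injective x)
    (hxS : ∀ i, x i ∈ barlowStacking 1 (Real.sqrt (2 / 3)) s) :
    ∑ i, ∑ j, (dist (x i) (x j))⁻¹ ^ 6 ≤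
      (N : ℝ) * ∑' y : ↥(hcpStacking 1 (Real.sqrt (2 / 3))), ‖(y : EuclideanSpace ℝ (Fin 3))‖⁻¹ ^ 6 := by
  classical
  have ha : (0 : ℝ) < 1 := one_pos
  have hh : 0 < Real.sqrt (2 / 3) := Real.sqrt_pos.2 (by norm_num)
  choose kf i_f j_f hxq using fun i => mem_barlowStacking_iff.1 (hxS i)
  set g : ℤ × ℤ × ℤ → EuclideanSpace ℝ (Fin 3) :=
    fun q => barlowPos 1 (Real.sqrt (2 / 3)) s q.1 q.2.1 q.2.2 with hgdef
  set Q : Fin N → ℤ × ℤ × ℤ := fun j => (kf j, i_f j, j_f j) with hQdef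
  have hQx : ∀ j, g (Q j) = x j := fun j => (hxq j).symm
  have hQ : Function.Injective Q := fun j j' hjj' => hx (by rw [← hQx j, ← hQx j', hjj'])
  have site : ∀ i, ∑ j, (dist (x i) (x j))⁻¹ ^ 6 ≤
      ∑' y : ↥(hcpStacking 1 (Real.sqrt (2 / 3))), ‖(y : EuclideanSpace ℝ (Fin 3))‖⁻¹ ^ 6 := by
    intro i
    have hF := summable_invSix_barlowPos_of_word ha hh s (x i)
    calc ∑ j, (dist (x i) (x j))⁻¹ ^ 6 = ∑ j, (dist (x i) (g (Q j)))⁻¹ ^ 6 := by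
          simp_rw [hQx]
      _ = ∑ q ∈ Finset.univ.image Q, (dist (x i) (g q))⁻¹ ^ 6 :=
          (Finset.sum_image (f := fun q => (dist (x i) (g q))⁻¹ ^ 6) fun j _ j' _ hjj' => hQ hjj').symm
      _ ≤ ∑' q : ℤ × ℤ × ℤ, (dist (x i) (g q))⁻¹ ^ 6 :=
          hF.sum_le_tsum _ fun q _ => by positivity
      _ = ∑' q : ℤ × ℤ × ℤ, (fun r : ℝ => r⁻¹ ^ 6)
            (dist (barlowPos 1 (Real.sqrt (2 / 3)) s (kf i) (i_f i) (j_f i))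
              (barlowPos 1 (Real.sqrt (2 / 3)) s q.1 q.2.1 q.2.2)) := by
          rw [hxq i]
      _ = 2 * barlowSiteEnergy (fun r : ℝ => r⁻¹ ^ 6) 1 (Real.sqrt (2 / 3)) s (kf i) := by
          rw [tsum_invSix_barlowPos_site, tsum_invSix_barlowPos_eq_two_mul_barlowSiteEnergy ha hh s]
      _ ≤ 2 * barlowSiteEnergy (fun r : ℝ => r⁻¹ ^ 6) 1 (Real.sqrt (2 / 3)) alternatingHagg 0 := by
          linarith [barlowSiteEnergy_invSix_le_alternating ha hh hs (kf i)]
      _ = ∑' y : ↥(hcpStacking 1 (Real.sqrt (2 / 3))), ‖(y : EuclideanSpace ℝ (Fin 3))‖⁻¹ ^ 6 :=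
          hcp_tsum_eq_two_mul_barlowSiteEnergy.symm
  calc ∑ i, ∑ j, (dist (x i) (x j))⁻¹ ^ 6
      ≤ ∑ _i : Fin N, ∑' y : ↥(hcpStacking 1 (Real.sqrt (2 / 3))),
          ‖(y : EuclideanSpace ℝ (Fin 3))‖⁻¹ ^ 6 := Finset.sum_le_sum fun i _ => site i
    _ = (N : ℝ) * ∑' y : ↥(hcpStacking 1 (Real.sqrt (2 / 3))),
          ‖(y : EuclideanSpace ℝ (Fin 3))‖⁻¹ ^ 6 := by
        rw [Finset.sum_const, Finset.card_univ, Fintype.card_fin, nsmul_eq_mul]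

/-- **The item's own form on the Barlow class**: for every Hägg word `s`, every `N` and every
`N`-point unit packing `x` of `ℝ³` whose points lie in `barlowStacking 1 √(2/3) s`,
`Σ_i Σ_j |x_i − x_j|⁻⁶ ≤ N · L₆(hcp)` — literally `SutherlandBound` with the extra hypothesis that
the packing is (part of) a close-packed stacking. [folklore] -/
theorem sutherlandBound_of_barlow_points {s : ℤ → ℤ} (hs : IsHaggSeq s) {N : ℕ}
    (x : Fin N → EuclideanSpace ℝ (Fin 3)) (hsep : ∀ i j, i ≠ j → 1 ≤ dist (x i) (x j))
    (hxS : ∀ i, x i ∈ barlowStacking 1 (Real.sqrt (2 / 3)) s) :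
    ∑ i, ∑ j, (dist (x i) (x j))⁻¹ ^ 6 ≤
      (N : ℝ) * ∑' y : ↥(hcpStacking 1 (Real.sqrt (2 / 3))), ‖(y : EuclideanSpace ℝ (Fin 3))‖⁻¹ ^ 6 := by
  refine sutherlandBound_barlow hs x (fun i j hij => ?_) hxS
  by_contra hne
  have h1 := hsep i j hne
  rw [hij, dist_self] at h1
  exact absurd h1 (by norm_num)

end Summit.AtomisticToContinuum.Crystallization.Theorems
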